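/-
COR-CM (cell pub-hodgecm2) — Δ2 ORIENTATION AUDIT, test T5: the NON-VACUITY TOKEN at a TOWER level.
Seat d2bridge-wb-8 g4 (prover-pub-hodgecm2-d2bridge-wb-8-g4-0), T2 pair wb-8 ∕ wb-9, 2026-08-23.
THEOREMS ONLY; nothing landed is edited or restated; no definition, no named fact, no `sorry`; explicit per-theorem binders.
HC_CM is NOT proved; «Δ2 BRIDGE CLOSED» is NOT claimed; no orientation verdict is asserted.
-/
import Summits.HodgeConjecture.HodgeCM.Model.ThetaSatDischarge
import Summits.HodgeConjecture.HodgeCM.Model.LevelPullInjective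
import Summits.HodgeConjecture.HodgeCM.Model.LevelConjugate
import HarnessLib

/-!
# T5 residual: a non-zero theta class at ANY level gives a non-zero theta class at a TOWER level

The T5 kernel files of the decider run (cm2 INBOX l.12380 `T5IsometricBlockObstruction`, l.12399 `T5ThetaSupplyHodgeClause`,
l.12427 ✔∕p373251 `OrientationT5ThetaLift`, l.12447 `T5AntiIsometricBlockObstruction`) all consume their non-vacuity token in the
shape «ONE non-zero theta class `ω ∈ Θ_k(Γ)` at a TOWER level `Γ` (`Γ.BelowConjThree`)», because the Liu–Albanese tower
`towerLevel … Γ hΓ` is indexed by the levels below a conjugate of `K_f(3)`.  The literal single-level non-vacuity statement of the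
theta model (`WeilPairData.supply`, `HodgeCM/Model/SupplyResidual.lean`: `∃ Γ, ∃ ω ∈ Θ(Γ), ω ≠ 0`) carries NO such side
condition.  All three T5 seats named the same residual (l.12399 «ONE RESIDUAL, stated not closed», l.12420 «SHARED RESIDUAL»):
«a non-zero theta class at any level yields a non-zero theta class at a tower level».

This file closes it, for the pinned theta sets `thetaOf _ (thetaClassInputOf _ (thetaSpaceInputOf hHD hI h₁ h₃ S)) V c k Γ` of ANY
adelic side `S` (both regime branches), by composing two tree theorems:
* ✔ `HodgeCM.Model.thetaSat_coverOf` (`ThetaSatDischarge.lean`) — for `Γ' ≤ Γ` the pull-back along the level covering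
  `coverOf … Γ Γ'` maps `Θ_k(Γ)` into `Θ_k(Γ')`;
* ✔ `HodgeCM.Model.LevelPullInjective.pull_baseChange_levelCover_injective` — that pull-back is injective on `H¹(P_Γ; ℚ)_ℂ`
  (finite covering, transfer), restated here on the end-state universe as `pullC_coverOf_injective`.

Main statements (namespace `Summit.HodgeConjecture.CorCM.D2Bridge`):
* `pullC_coverOf_injective` — `(picardCMUniverse …).pullC (coverOf … Γ Γ' hle) k` is injective;
* `exists_mem_thetaOf_ne_zero_of_le` — a non-zero theta class at `Γ` gives one at every `Γ' ≤ Γ`;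
* `exists_belowConjThree_mem_thetaOf_ne_zero` — … in particular at the tower level `Γ ⊓ Level.three V`;
* `exists_mem_thetaOf_ne_zero_iff_belowConjThree` — the two non-vacuity tokens (any level ∕ tower level) are EQUIVALENT;
* `exists_belowConjThree_mem_thetaOf_ne_zero_of_subset` — the same from the supply of any levelwise SUB-family `Θfam Γ ⊆ Θ_k(Γ)`
  (the literal `WeilPairData.supply` shape `∃ Γ, ∃ ω ∈ Θfam Γ, ω ≠ 0`).

Deliberately NOT here: any Hodge-type clause, any dictionary, any orientation reading — this is the level bookkeeping only; the
consumers are the T5 theorems above (feed `exists_belowConjThree_mem_thetaOf_ne_zero` into their `hΓ ∕ hω ∕ hne` binders).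
[cite: HatcherAT2002, §3.G Prop. 3G.1]
-/

set_option autoImplicit false

noncomputable section

open Function
open Literature.AlgebraicGeometry.HodgeTheory
open Literature.NumberTheory.Automorphic Literature.NumberTheory.Automorphic.PicardCM
open Literature.NumberTheory.Transcendental (Arapura2012_Cor_15_4_6)
open HodgeCM HodgeCM.Model

namespace Summit.HodgeConjecture.CorCM.D2Bridge

variable {L : CMField} {ι₁ : L →+* ℂ}

/-! ## §1 The level covering pulls back injectively on the end-state universe -/

/-- **Injectivity of the pull-back along a level covering** of the model universe `picardCMUniverse`: for `Γ'.Γ ≤ Γ.Γ` the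
complexified pull-back `coverOf(Γ, Γ')^* : H^k(P_Γ; ℚ)_ℂ → H^k(P_{Γ'}; ℚ)_ℂ` is injective (finite covering ⇒ the normalised
transfer is a retraction; tree: `LevelPullInjective.pull_baseChange_levelCover_injective`, of which this is the `pullC ∘ coverOf`
spelling, definitionally). [cite: HatcherAT2002, §3.G Prop. 3G.1] -/
theorem pullC_coverOf_injective (hHD : exists_isReal_hodgeModel) (hI : hodgePQ_independent_of_hodgeModel)
    (h₁ : BallQuotientUniformised) (h₃ : CMAbelianVarietyRealised) (hA : Arapura2012_Cor_15_4_6)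
    {V : HermSpace3 L ι₁} {Γ Γ' : Level V} (hle : Γ'.Γ ≤ Γ.Γ) (k : ℕ) :
    Injective ((picardCMUniverse hHD hI h₁ h₃).pullC (coverOf hHD hI h₁ h₃ hA Γ Γ' hle) k) := by
  have e : ⇑((picardCMUniverse hHD hI h₁ h₃).pullC (coverOf hHD hI h₁ h₃ hA Γ Γ' hle) k) =
      ⇑((BettiUniverse.pull (levelCover (ballQuotientUniformisedDatum_of h₁) h₃ hHD hA Γ Γ' hle) k).baseChange ℂ) := rfl
  rw [e]
  exact LevelPullInjective.pull_baseChange_levelCover_injective hHD (ballQuotientUniformisedDatum_of h₁) h₃ hA hle k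

/-! ## §2 Theta classes: non-vanishing descends along the level covering -/

/-- **A non-zero theta class at `Γ` gives a non-zero theta class at every smaller level `Γ' ≤ Γ`** (pinned theta sets of any
adelic side `S`, any slot `k`): its pull-back along `coverOf … Γ Γ'` is again a theta class (✔ `thetaSat_coverOf`) and is
non-zero (`pullC_coverOf_injective`). [folklore] -/
theorem exists_mem_thetaOf_ne_zero_of_le (hHD : exists_isReal_hodgeModel) (hI : hodgePQ_independent_of_hodgeModel)
    (h₁ : BallQuotientUniformised) (h₃ : CMAbelianVarietyRealised) (hA : Arapura2012_Cor_15_4_6)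
    (S : ∀ {L : CMField} {ι₁ : L →+* ℂ} (V : HermSpace3 L ι₁) (c : SeesawCtx L), ThetaAdelicSide V c)
    (V : HermSpace3 L ι₁) (c : SeesawCtx L) (k : Fin 4) {Γ Γ' : Level V} (hle : Γ' ≤ Γ)
    {ω : (picardCMUniverse hHD hI h₁ h₃).CohC ((picardCMUniverse hHD hI h₁ h₃).pms L ι₁ V Γ) 1}
    (hω : ω ∈ thetaOf _ (thetaClassInputOf _ (fun V c => thetaSpaceInputOf hHD hI h₁ h₃ S V c)) V c k Γ) (hne : ω ≠ 0) :
    ∃ ω' ∈ thetaOf _ (thetaClassInputOf _ (fun V c => thetaSpaceInputOf hHD hI h₁ h₃ S V c)) V c k Γ', ω' ≠ 0 := by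
  refine ⟨(picardCMUniverse hHD hI h₁ h₃).pullC (coverOf hHD hI h₁ h₃ hA Γ Γ' (Level.Γ_mono hle)) 1 ω,
    thetaSat_coverOf hHD hI h₁ h₃ S hA V c k Γ Γ' hle ω hω, ?_⟩
  intro h0
  exact hne (pullC_coverOf_injective hHD hI h₁ h₃ hA (Level.Γ_mono hle) 1 (h0.trans (map_zero _).symm))

/-- **The T5 residual, closed: a non-zero theta class at ANY level `Γ` gives a non-zero theta class at a TOWER level** — namely at
`Γ ⊓ Level.three V ≤ Γ`, which lies below (a conjugate of) `K_f(3)` (`Level.belowConjThree_of_le_three`).  This is the exact lemma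
named by the T5 seats (cm2 INBOX l.12399 ∕ l.12420) for consuming the literal single-level supply `∃ Γ, ∃ ω ∈ Θ(Γ), ω ≠ 0`.
[folklore] -/
theorem exists_belowConjThree_mem_thetaOf_ne_zero (hHD : exists_isReal_hodgeModel)
    (hI : hodgePQ_independent_of_hodgeModel) (h₁ : BallQuotientUniformised) (h₃ : CMAbelianVarietyRealised)
    (hA : Arapura2012_Cor_15_4_6)
    (S : ∀ {L : CMField} {ι₁ : L →+* ℂ} (V : HermSpace3 L ι₁) (c : SeesawCtx L), ThetaAdelicSide V c)
    (V : HermSpace3 L ι₁) (c : SeesawCtx L) (k : Fin 4) (Γ : Level V)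
    {ω : (picardCMUniverse hHD hI h₁ h₃).CohC ((picardCMUniverse hHD hI h₁ h₃).pms L ι₁ V Γ) 1}
    (hω : ω ∈ thetaOf _ (thetaClassInputOf _ (fun V c => thetaSpaceInputOf hHD hI h₁ h₃ S V c)) V c k Γ) (hne : ω ≠ 0) :
    ∃ Γ' : Level V, Γ' ≤ Γ ∧ Γ'.BelowConjThree ∧
      ∃ ω' ∈ thetaOf _ (thetaClassInputOf _ (fun V c => thetaSpaceInputOf hHD hI h₁ h₃ S V c)) V c k Γ', ω' ≠ 0 :=
  ⟨Γ ⊓ Level.three V, inf_le_left, Level.belowConjThree_of_le_three inf_le_right,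
    exists_mem_thetaOf_ne_zero_of_le hHD hI h₁ h₃ hA S V c k inf_le_left hω hne⟩

/-- **The two non-vacuity tokens are equivalent**: «some non-zero theta class at SOME level» ↔ «some non-zero theta class at some
TOWER level (below a conjugate of `K_f(3)`)», for the pinned theta sets of any adelic side `S` and any slot `k`. [folklore] -/
theorem exists_mem_thetaOf_ne_zero_iff_belowConjThree (hHD : exists_isReal_hodgeModel)
    (hI : hodgePQ_independent_of_hodgeModel) (h₁ : BallQuotientUniformised) (h₃ : CMAbelianVarietyRealised)
    (hA : Arapura2012_Cor_15_4_6)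
    (S : ∀ {L : CMField} {ι₁ : L →+* ℂ} (V : HermSpace3 L ι₁) (c : SeesawCtx L), ThetaAdelicSide V c)
    (V : HermSpace3 L ι₁) (c : SeesawCtx L) (k : Fin 4) :
    (∃ Γ : Level V,
        ∃ ω ∈ thetaOf _ (thetaClassInputOf _ (fun V c => thetaSpaceInputOf hHD hI h₁ h₃ S V c)) V c k Γ, ω ≠ 0) ↔
      ∃ Γ : Level V, Γ.BelowConjThree ∧
        ∃ ω ∈ thetaOf _ (thetaClassInputOf _ (fun V c => thetaSpaceInputOf hHD hI h₁ h₃ S V c)) V c k Γ, ω ≠ 0 := by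
  constructor
  · rintro ⟨Γ, ω, hω, hne⟩
    obtain ⟨Γ', -, hΓ', hω'⟩ := exists_belowConjThree_mem_thetaOf_ne_zero hHD hI h₁ h₃ hA S V c k Γ hω hne
    exact ⟨Γ', hΓ', hω'⟩
  · rintro ⟨Γ, -, hω⟩
    exact ⟨Γ, hω⟩

/-- **Consuming a literal single-level supply.**  For any family of classes `Θfam Γ ⊆ Θ_k(Γ)` contained levelwise in the pinned
theta sets (e.g. a theta model's `T.Theta V c k` under its inclusion hypothesis), the supply conclusion
«`∃ Γ, ∃ ω ∈ Θfam Γ, ω ≠ 0`» (the shape of `WeilPairData.supply`, `HodgeCM/Model/SupplyResidual.lean`) yields the TOWER-level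
non-vacuity token «`∃ Γ, Γ.BelowConjThree ∧ ∃ ω ∈ Θ_k(Γ), ω ≠ 0`» that the T5 theorems consume. [folklore] -/
theorem exists_belowConjThree_mem_thetaOf_ne_zero_of_subset (hHD : exists_isReal_hodgeModel)
    (hI : hodgePQ_independent_of_hodgeModel) (h₁ : BallQuotientUniformised) (h₃ : CMAbelianVarietyRealised)
    (hA : Arapura2012_Cor_15_4_6)
    (S : ∀ {L : CMField} {ι₁ : L →+* ℂ} (V : HermSpace3 L ι₁) (c : SeesawCtx L), ThetaAdelicSide V c)
    (V : HermSpace3 L ι₁) (c : SeesawCtx L) (k : Fin 4)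
    (Θfam : ∀ Γ : Level V, Set ((picardCMUniverse hHD hI h₁ h₃).CohC ((picardCMUniverse hHD hI h₁ h₃).pms L ι₁ V Γ) 1))
    (hsub : ∀ Γ : Level V,
      Θfam Γ ⊆ thetaOf _ (thetaClassInputOf _ (fun V c => thetaSpaceInputOf hHD hI h₁ h₃ S V c)) V c k Γ)
    (h : ∃ Γ : Level V, ∃ ω ∈ Θfam Γ, ω ≠ 0) :
    ∃ Γ : Level V, Γ.BelowConjThree ∧
      ∃ ω ∈ thetaOf _ (thetaClassInputOf _ (fun V c => thetaSpaceInputOf hHD hI h₁ h₃ S V c)) V c k Γ, ω ≠ 0 := by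
  obtain ⟨Γ, ω, hω, hne⟩ := h
  exact (exists_mem_thetaOf_ne_zero_iff_belowConjThree hHD hI h₁ h₃ hA S V c k).1 ⟨Γ, ω, hsub Γ hω, hne⟩

end Summit.HodgeConjecture.CorCM.D2Bridge

end
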